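import Literature.Topology.FourManifolds.FlipPair
import Literature.Topology.FourManifolds.DeepArc
import Literature.Topology.FourManifolds.ParamGlue
import Literature.Topology.FourManifolds.WallSpikes
import Literature.Topology.FourManifolds.ConeGeometry
import HarnessLib

/-!
# The flip frame of a flip pair: native necks, reflected deep arc

Topic `Literature/Topology/FourManifolds` (trunk T-4MAN). Fact seat
`provefact-Literature.Topology.FourManifolds.Knot.IsConnectedSum.isIsotopic` (Schubert's theorem),
geometric heart for rail knots. For a flip pair `(b₁, b₂)` (`FlipPair.lean`) in normal position at
a common neck scale `κ`, the **flip frame** (family parameter `u ∈ [0, 1]`) is the piece function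
on the circle of `b₁` which is

* the necked piece function of `b₁` on the native zone `[parLo₁ (-1), parHi₁ (-1)]` (levels
  `≥ -1` on both cores: the whole southern side of `b₁` and its flat northern necks down to level
  `-1`);
* the reflection `R` of the deep arc of `b₂` (`DeepArc.lean`, family parameter `u`) on the
  foreign zone, glued through the junction clock of `ParamGlue.lean` (clamped to be globally
  defined): at the junctions both formulas are the same flat neck points (`FlipPair`'s neck
  correspondence), so the frame is `C^∞` (`contDiff_flipBase`).

This file: the definition (`flipBase`), zone and junction formulas, joint smoothness, the seam
property, unit norm, regularity and injectivity on the fundamental domain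
(`isRegularLoop_flipBase`, `injOn_flipBase`), and the hemispheres of its points. The wall, bend
and neck-frame properties are in `FlipWall.lean`.

Everything is proved; no named facts are introduced.

## References

Standard; all statements `[folklore]`.
-/

open scoped Manifold ContDiff Topology Real
open Function Set Metric Filter

noncomputable section

namespace Literature.Topology.FourManifolds

/-- Local notation: `𝔼 n` is the model Euclidean space `EuclideanSpace ℝ (Fin n)`. -/
local notation "𝔼 " n:arg => EuclideanSpace ℝ (Fin n)

/-- Local notation: `𝕊 n` is the unit sphere in `EuclideanSpace ℝ (Fin (n + 1))`. -/
local notation "𝕊 " n:arg => (Metric.sphere (0 : EuclideanSpace ℝ (Fin (n + 1))) 1)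

attribute [local instance] fact_finrank_euclideanSpace_succ

open KnotsInBall

namespace BandData

/-! ### The reflection on coerced sphere points -/

/-- **The reflection in the last coordinate as a continuous linear map of `ℝ⁴`.** [folklore] -/
def reflLin : (𝔼 4) →L[ℝ] 𝔼 4 :=
  ContinuousLinearMap.id ℝ (𝔼 4) - (2 : ℝ) • (ContinuousLinearMap.smulRight (EuclideanSpace.proj (Fin.last 3)) ((northPole : 𝕊 3) : 𝔼 4))

/-- The linear reflection as a formula. [folklore] -/
theorem reflLin_apply (v : 𝔼 4) : reflLin v = v - (2 * v (Fin.last 3)) • ((northPole : 𝕊 3) : 𝔼 4) := by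
  change v - (2 : ℝ) • ((v (Fin.last 3)) • ((northPole : 𝕊 3) : 𝔼 4)) = _
  rw [smul_smul]

/-- The linear reflection on a coerced sphere point is the coerced reflected point. [folklore] -/
theorem reflLin_coe (x : 𝕊 3) : reflLin (x : 𝔼 4) = ((reflectLast 3 x : 𝕊 3) : 𝔼 4) := by
  rw [coe_reflectLast_eq_sub, reflLin_apply]

/-- The linear reflection is an involution. [folklore] -/
theorem reflLin_reflLin (v : 𝔼 4) : reflLin (reflLin v) = v := by
  rw [reflLin_apply, reflLin_apply]
  ext i
  simp only [PiLp.sub_apply, PiLp.smul_apply, smul_eq_mul, coe_northPole, PiLp.single_apply]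
  split_ifs with hi
  · subst hi; ring
  · ring

/-- The linear reflection is injective. [folklore] -/
theorem reflLin_injective : Injective reflLin := fun u v h ↦ by rw [← reflLin_reflLin u, ← reflLin_reflLin v, h]

/-- **A curve `↑R (ψ⁻¹ ∘ γ)` is regular where `γ` is.** [folklore] -/
theorem deriv_coe_reflectLast_psiN_symm_comp_ne_zero {γ : ℝ → 𝔼 3} {γ' : 𝔼 3} {t : ℝ} (hγ : HasDerivAt γ γ' t) (hne : γ' ≠ 0) :
    deriv (fun s ↦ ((reflectLast 3 (psiN.symm (γ s)) : 𝕊 3) : 𝔼 4)) t ≠ 0 := by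
  have h1 : (fun s ↦ ((reflectLast 3 (psiN.symm (γ s)) : 𝕊 3) : 𝔼 4)) = reflLin ∘ fun s ↦ ((psiN.symm (γ s) : 𝕊 3) : 𝔼 4) := by
    funext s; simp only [comp_apply, reflLin_coe]
  rw [h1]
  have hd : DifferentiableAt ℝ (fun s ↦ ((psiN.symm (γ s) : 𝕊 3) : 𝔼 4)) t :=
    ((contDiff_coe_psiN_symm.differentiable (by simp)) (γ t)).comp t hγ.differentiableAt
  rw [(reflLin.hasFDerivAt.comp_hasDerivAt t hd.hasDerivAt).deriv]
  intro h0
  exact deriv_coe_psiN_symm_comp_ne_zero hγ hne (reflLin_injective (by rw [h0, map_zero]))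

/-- **`↑R ∘ ψ⁻¹` is `C^∞`.** [folklore] -/
theorem contDiff_coe_reflectLast_psiN_symm : ContDiff ℝ ∞ (fun y : 𝔼 3 ↦ ((reflectLast 3 (psiN.symm y) : 𝕊 3) : 𝔼 4)) := by
  have h1 : (fun y : 𝔼 3 ↦ ((reflectLast 3 (psiN.symm y) : 𝕊 3) : 𝔼 4)) = reflLin ∘ fun y ↦ ((psiN.symm y : 𝕊 3) : 𝔼 4) := by
    funext y; simp only [comp_apply, reflLin_coe]
  rw [h1]; exact reflLin.contDiff.comp contDiff_coe_psiN_symm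

/-- `↑R ∘ ψ⁻¹` is injective. [folklore] -/
theorem coe_reflectLast_psiN_symm_injective : Injective (fun y : 𝔼 3 ↦ ((reflectLast 3 (psiN.symm y) : 𝕊 3) : 𝔼 4)) := by
  intro y y' h
  have h' : reflLin ((psiN.symm y : 𝕊 3) : 𝔼 4) = reflLin ((psiN.symm y' : 𝕊 3) : 𝔼 4) := by
    rw [reflLin_coe, reflLin_coe]; exact h
  exact coe_psiN_symm_injective (reflLin_injective h')

/-! ### Arc scales -/

variable {A B K : Knot} (b : BandData A B K ∅)
  (hcross : b.band ⁻¹' sphereEquator 2 ∩ squareNhd b.δ = {x ∈ squareNhd b.δ | x 0 = 2⁻¹})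

/-- **Arc scales** for the deep arc of `b` at neck scale `κ`: a flatness package of tolerance
`ε ≤ 1/256` (good for the chord) and radius `r > 9κ`, with `9κ < 1/2`, `7κ ≤ gapLo, gapHi` and
`9κ ‖frame‖ ≤ 1`. [folklore] -/
structure ArcScale (ε r κ : ℝ) : Prop where
  flat : b.IsFlat hcross ε r
  κ_pos : 0 < κ
  eps_le : ε ≤ 1 / 256
  good : ε * (6 + 8 * chordBumpBound) ≤ 1 / 2
  nine_lt_r : κ * 9 < r
  nine_lt_half : κ * 9 < 2⁻¹
  seven_le_gapLo : 7 * κ ≤ b.gapLo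
  seven_le_gapHi : 7 * κ ≤ b.gapHi
  frame_small : 9 * κ * ‖((b.frame hcross : (𝔼 3) ≃L[ℝ] 𝔼 3) : (𝔼 3) →L[ℝ] 𝔼 3)‖ ≤ 1

namespace ArcScale

variable {b hcross} {ε r κ : ℝ} (h : b.ArcScale hcross ε r κ)
include h

/-- `9κ ≤ poleRad`. [folklore] -/
theorem nine_le_poleRad : κ * 9 ≤ b.poleRad hcross := h.nine_lt_r.le.trans h.flat.r_le

/-- `8κ ≤ poleRad`. [folklore] -/
theorem eight_le_poleRad : 8 * κ ≤ b.poleRad hcross := by have := h.nine_le_poleRad; have := h.κ_pos; linarith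

/-- `ε ≤ 1/64`. [folklore] -/
theorem eps_le_64 : ε ≤ 1 / 64 := by linarith [h.eps_le]

/-- `ε < 1`. [folklore] -/
theorem eps_lt_one : ε < 1 := by linarith [h.eps_le]

/-- `ε ≤ 1/8`. [folklore] -/
theorem eps_le_8 : ε ≤ 1 / 8 := by linarith [h.eps_le]

end ArcScale

/-- **Arc scales exist**: for some `ε, r` every small enough `κ` is an arc scale. [folklore] -/
theorem exists_arcScale : ∃ ε r κ₀ : ℝ, 0 < κ₀ ∧ ∀ κ, 0 < κ → κ ≤ κ₀ → b.ArcScale hcross ε r κ := by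
  have hB : 0 ≤ chordBumpBound := chordBumpBound_spec.1
  set ε : ℝ := min (1 / 256) (1 / (2 * (6 + 8 * chordBumpBound))) with hε
  have hε0 : 0 < ε := lt_min (by norm_num) (by positivity)
  obtain ⟨r, hf⟩ := b.exists_isFlat hcross hε0
  have hr := hf.r_pos
  have hg := b.gapLo_pos
  have hg' := b.gapHi_pos
  set N : ℝ := ‖((b.frame hcross : (𝔼 3) ≃L[ℝ] 𝔼 3) : (𝔼 3) →L[ℝ] 𝔼 3)‖ with hN
  have hN0 : 0 ≤ N := norm_nonneg _
  set κ₀ : ℝ := min (r / 10) (min (1 / 20) (min (b.gapLo / 7) (min (b.gapHi / 7) (1 / (9 * (N + 1)))))) with hκ₀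
  have hκ₀0 : 0 < κ₀ := by positivity
  refine ⟨ε, r, κ₀, hκ₀0, fun κ hκ hκ1 ↦ ?_⟩
  have h1 : κ ≤ r / 10 := hκ1.trans (min_le_left _ _)
  have h2 : κ ≤ 1 / 20 := hκ1.trans ((min_le_right _ _).trans (min_le_left _ _))
  have h3 : κ ≤ b.gapLo / 7 := hκ1.trans ((min_le_right _ _).trans ((min_le_right _ _).trans (min_le_left _ _)))
  have h4 : κ ≤ b.gapHi / 7 :=
    hκ1.trans ((min_le_right _ _).trans ((min_le_right _ _).trans ((min_le_right _ _).trans (min_le_left _ _))))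
  have h5 : κ ≤ 1 / (9 * (N + 1)) :=
    hκ1.trans ((min_le_right _ _).trans ((min_le_right _ _).trans ((min_le_right _ _).trans (min_le_right _ _))))
  refine ⟨hf, hκ, min_le_left _ _, ?_, by linarith, by linarith, by linarith, by linarith, ?_⟩
  · have : ε ≤ 1 / (2 * (6 + 8 * chordBumpBound)) := min_le_right _ _
    rw [le_div_iff₀ (by positivity)] at this
    linarith
  · rw [le_div_iff₀ (by positivity)] at h5
    nlinarith

/-! ### Levels -/

omit b in
/-- `-1 ∈ [-7, 7]`. [folklore] -/
theorem neg_one_mem : (-1 : ℝ) ∈ Icc (-7 : ℝ) 7 := ⟨by norm_num, by norm_num⟩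

omit b in
/-- `-3/4 ∈ [-7, 7]`. [folklore] -/
theorem neg_three_quarters_mem : (-(3 / 4) : ℝ) ∈ Icc (-7 : ℝ) 7 := ⟨by norm_num, by norm_num⟩

omit b in
/-- `-5/4 ∈ [-7, 7]`. [folklore] -/
theorem neg_five_quarters_mem : (-(5 / 4) : ℝ) ∈ Icc (-7 : ℝ) 7 := ⟨by norm_num, by norm_num⟩

omit b in
/-- `-7/2 ∈ [-7, 7]`. [folklore] -/
theorem neg_seven_halves_mem : (-(7 / 2) : ℝ) ∈ Icc (-7 : ℝ) 7 := ⟨by norm_num, by norm_num⟩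

omit b in
/-- `0 ∈ [-7, 7]`. [folklore] -/
theorem zero_mem7 : (0 : ℝ) ∈ Icc (-7 : ℝ) 7 := ⟨by norm_num, by norm_num⟩

include hcross in
/-- A band point with first planar coordinate `≤ 1/2` is in the closed northern hemisphere (`A`
north, normal position). [folklore] -/
theorem band_last_nonneg_of_le_half (hA : A.InNorth) {x : 𝔼 2} (hx : x ∈ squareNhd b.δ) (h0 : x 0 ≤ 2⁻¹) :
    0 ≤ ((b.band x : 𝕊 3) : 𝔼 4) (Fin.last 3) := by
  rcases h0.lt_or_eq with h | h
  · exact (b.band_last_pos_of_lt_half hA hcross hx h).le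
  · have hmem : x ∈ b.band ⁻¹' sphereEquator 2 ∩ squareNhd b.δ := by rw [hcross]; exact ⟨hx, h⟩
    exact ((mem_sphereEquator_iff _).1 hmem.1).ge

omit b in
/-- `[0, 1] ⊆ [-7, 7]`. [folklore] -/
theorem mem7_of_mem01 {v : ℝ} (hv : v ∈ Icc (0 : ℝ) 1) : v ∈ Icc (-7 : ℝ) 7 := ⟨by linarith [hv.1], by linarith [hv.2]⟩

/-- `parLo` only depends on the level. [folklore] -/
theorem parLo_congr' {κ : ℝ} (hκ : 0 < κ) (h7 : 7 * κ ≤ b.gapLo) {v w : ℝ} (hv : v ∈ Icc (-7 : ℝ) 7) (hw : w ∈ Icc (-7 : ℝ) 7)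
    (h : v = w) : b.parLo hκ h7 hv = b.parLo hκ h7 hw :=
  le_antisymm (b.parLo_le_parLo hκ h7 hv hw h.le) (b.parLo_le_parLo hκ h7 hw hv h.ge)

/-- `parHi` only depends on the level. [folklore] -/
theorem parHi_congr' {κ : ℝ} (hκ : 0 < κ) (h7' : 7 * κ ≤ b.gapHi) {v w : ℝ} (hv : v ∈ Icc (-7 : ℝ) 7) (hw : w ∈ Icc (-7 : ℝ) 7)
    (h : v = w) : b.parHi hκ h7' hv = b.parHi hκ h7' hw :=
  le_antisymm (b.parHi_le_parHi hκ h7' hw hv h.ge) (b.parHi_le_parHi hκ h7' hv hw h.le)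

/-! ### The flip frame -/

section Flip

variable {A₁ B₁ K₁ : Knot} {b₁ : BandData A₁ B₁ K₁ ∅} {A₂ B₂ K₂ : Knot} {b₂ : BandData A₂ B₂ K₂ ∅}
  {hcross₁ : b₁.band ⁻¹' sphereEquator 2 ∩ squareNhd b₁.δ = {x ∈ squareNhd b₁.δ | x 0 = 2⁻¹}}
  {hcross₂ : b₂.band ⁻¹' sphereEquator 2 ∩ squareNhd b₂.δ = {x ∈ squareNhd b₂.δ | x 0 = 2⁻¹}}
  {σ₁ ε₁ r₁ A₁' κ ε₂ r₂ : ℝ}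
  (h₁ : b₁.SpikeScale hcross₁ σ₁ ε₁ r₁ A₁' κ) (h₂ : b₂.ArcScale hcross₂ ε₂ r₂ κ)

/-- **The junction clock of the pair**, `ParamGlue.junctionClock` at the spike/arc scales.
[folklore] -/
def jc : ℝ → ℝ :=
  junctionClock b₁ b₂ h₁.κ_pos h₁.seven_le_gapLo h₁.seven_le_gapHi h₂.seven_le_gapLo h₂.seven_le_gapHi

/-- **The clamp of the foreign zone**: a `C^∞` map `ℝ → (parHi₁ (-1/2), parLo₁ (-1/2) + 1)` which
is the identity on `[parHi₁ (-3/4), parLo₁ (-3/4) + 1]`. [folklore] -/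
theorem exists_clamp :
    ∃ cl : ℝ → ℝ, ContDiff ℝ ∞ cl ∧
      (∀ t ∈ Icc (b₁.parHi h₁.κ_pos h₁.seven_le_gapHi neg_three_quarters_mem)
        (b₁.parLo h₁.κ_pos h₁.seven_le_gapLo neg_three_quarters_mem + 1), cl t = t) ∧
      ∀ t, cl t ∈ Ioo (b₁.parHi h₁.κ_pos h₁.seven_le_gapHi neg_half_mem) (b₁.parLo h₁.κ_pos h₁.seven_le_gapLo neg_half_mem + 1) := by
  have hκ := h₁.κ_pos
  refine exists_contDiff_clamp (b₁.parHi_lt_parHi hκ h₁.seven_le_gapHi neg_three_quarters_mem neg_half_mem (by norm_num)) ?_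
    (by linarith [b₁.parLo_lt_parLo hκ h₁.seven_le_gapLo neg_three_quarters_mem neg_half_mem (by norm_num)])
  have h1 := (b₁.parHi_mem_core hκ h₁.seven_le_gapHi neg_three_quarters_mem).2
  have h2 := (b₁.parLo_mem_core hκ h₁.seven_le_gapLo neg_three_quarters_mem).1
  have := b₁.core_marks; linarith

/-- The clamp (chosen). [folklore] -/
def clamp : ℝ → ℝ := (exists_clamp h₁).choose

/-- The clamp is `C^∞`. [folklore] -/
theorem contDiff_clamp : ContDiff ℝ ∞ (clamp h₁) := (exists_clamp h₁).choose_spec.1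

/-- The clamp is the identity on `[parHi₁ (-3/4), parLo₁ (-3/4) + 1]`. [folklore] -/
theorem clamp_eq {t : ℝ} (ht : t ∈ Icc (b₁.parHi h₁.κ_pos h₁.seven_le_gapHi neg_three_quarters_mem)
    (b₁.parLo h₁.κ_pos h₁.seven_le_gapLo neg_three_quarters_mem + 1)) : clamp h₁ t = t :=
  (exists_clamp h₁).choose_spec.2.1 t ht

/-- The clamp takes values in the open foreign zone of level `-1/2`. [folklore] -/
theorem clamp_mem (t : ℝ) :
    clamp h₁ t ∈ Ioo (b₁.parHi h₁.κ_pos h₁.seven_le_gapHi neg_half_mem) (b₁.parLo h₁.κ_pos h₁.seven_le_gapLo neg_half_mem + 1) :=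
  (exists_clamp h₁).choose_spec.2.2 t

include h₁ h₂

/-- **The clamped junction clock** `Θ = ϑ ∘ clamp`: globally `C^∞`, with values in
`[parLo₂ (1/2), parHi₂ (1/2)]`, equal to `ϑ` on `[parHi₁ (-3/4), parLo₁ (-3/4) + 1]`. [folklore] -/
def theta (t : ℝ) : ℝ := jc h₁ h₂ (clamp h₁ t)

/-- `Θ` is `C^∞`. [folklore] -/
theorem contDiff_theta : ContDiff ℝ ∞ (theta h₁ h₂) :=
  (contDiff_junctionClock b₁ b₂ h₁.κ_pos h₁.seven_le_gapLo h₁.seven_le_gapHi h₂.seven_le_gapLo h₂.seven_le_gapHi).comp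
    (contDiff_clamp h₁)

/-- `Θ = ϑ` on `[parHi₁ (-3/4), parLo₁ (-3/4) + 1]`. [folklore] -/
theorem theta_eq {t : ℝ} (ht : t ∈ Icc (b₁.parHi h₁.κ_pos h₁.seven_le_gapHi neg_three_quarters_mem)
    (b₁.parLo h₁.κ_pos h₁.seven_le_gapLo neg_three_quarters_mem + 1)) : theta h₁ h₂ t = jc h₁ h₂ t := by
  rw [theta, clamp_eq h₁ ht]

/-- **`Θ` takes values in `[parLo₂ (1/2), parHi₂ (1/2)]`.** [folklore] -/
theorem theta_mem (t : ℝ) :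
    theta h₁ h₂ t ∈ Icc (b₂.parLo h₁.κ_pos h₂.seven_le_gapLo half_mem) (b₂.parHi h₁.κ_pos h₂.seven_le_gapHi half_mem) :=
  junctionClock_mem b₁ b₂ h₁.κ_pos h₁.seven_le_gapLo h₁.seven_le_gapHi h₂.seven_le_gapLo h₂.seven_le_gapHi
    (Ioo_subset_Icc_self (clamp_mem h₁ t))

/-- `Θ` takes values in the arc domain `[parLo₂ (-3), parHi₂ (-3)]`. [folklore] -/
theorem theta_mem' (t : ℝ) :
    theta h₁ h₂ t ∈ Icc (b₂.parLo h₁.κ_pos h₂.seven_le_gapLo neg_three_mem) (b₂.parHi h₁.κ_pos h₂.seven_le_gapHi neg_three_mem) := by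
  have h := theta_mem h₁ h₂ t
  exact ⟨le_trans (b₂.parLo_le_parLo h₁.κ_pos h₂.seven_le_gapLo neg_three_mem half_mem (by norm_num)) h.1,
    le_trans h.2 (b₂.parHi_le_parHi h₁.κ_pos h₂.seven_le_gapHi neg_three_mem half_mem (by norm_num))⟩

/-- `Θ` takes values in the open smooth domain `(parLo₂ (-7), parHi₂ (-7))`. [folklore] -/
theorem theta_mem_Ioo (t : ℝ) :
    theta h₁ h₂ t ∈ Ioo (b₂.parLo h₁.κ_pos h₂.seven_le_gapLo neg_seven_mem) (b₂.parHi h₁.κ_pos h₂.seven_le_gapHi neg_seven_mem) := by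
  have h := theta_mem h₁ h₂ t
  exact ⟨lt_of_lt_of_le (b₂.parLo_lt_parLo h₁.κ_pos h₂.seven_le_gapLo neg_seven_mem half_mem (by norm_num)) h.1,
    lt_of_le_of_lt h.2 (b₂.parHi_lt_parHi h₁.κ_pos h₂.seven_le_gapHi neg_seven_mem half_mem (by norm_num))⟩

/-- **The reflected deep-arc point** of `b₂` at family parameter `u` and arc parameter `τ`.
[folklore] -/
def foreignPt (u τ : ℝ) : 𝔼 4 :=
  ((reflectLast 3 (psiN.symm (b₂.arcChart h₁.κ_pos h₂.seven_le_gapLo h₂.seven_le_gapHi u τ)) : 𝕊 3) : 𝔼 4)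

/-- The reflected deep-arc point is a unit vector. [folklore] -/
theorem norm_foreignPt (u τ : ℝ) : ‖foreignPt h₁ h₂ u τ‖ = 1 := by
  rw [foreignPt]; exact norm_eq_of_mem_sphere _

/-- **The flip frame**: the reflected arc (through `Θ (s + 1)`) before `parLo₁ (-1)`, the necked
piece function of `b₁` on `[parLo₁ (-1), parHi₁ (-1)]`, the reflected arc (through `Θ s`) after.
[folklore] -/
def flipBase (u s : ℝ) : 𝔼 4 :=
  if s < b₁.parLo h₁.κ_pos h₁.seven_le_gapLo neg_one_mem then foreignPt h₁ h₂ u (theta h₁ h₂ (s + 1))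
  else if s ≤ b₁.parHi h₁.κ_pos h₁.seven_le_gapHi neg_one_mem then b₁.neckPiece κ 1 s
  else foreignPt h₁ h₂ u (theta h₁ h₂ s)

/-- The flip frame on the early foreign zone. [folklore] -/
theorem flipBase_of_lt {u s : ℝ} (hs : s < b₁.parLo h₁.κ_pos h₁.seven_le_gapLo neg_one_mem) :
    flipBase h₁ h₂ u s = foreignPt h₁ h₂ u (theta h₁ h₂ (s + 1)) := by simp [flipBase, hs]

/-- The flip frame on the native zone. [folklore] -/
theorem flipBase_of_mem {u s : ℝ}
    (hs : s ∈ Icc (b₁.parLo h₁.κ_pos h₁.seven_le_gapLo neg_one_mem) (b₁.parHi h₁.κ_pos h₁.seven_le_gapHi neg_one_mem)) :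
    flipBase h₁ h₂ u s = b₁.neckPiece κ 1 s := by simp [flipBase, not_lt.2 hs.1, hs.2]

/-- The flip frame on the late foreign zone. [folklore] -/
theorem flipBase_of_gt {u s : ℝ} (hs : b₁.parHi h₁.κ_pos h₁.seven_le_gapHi neg_one_mem < s) :
    flipBase h₁ h₂ u s = foreignPt h₁ h₂ u (theta h₁ h₂ s) := by
  have h1 : ¬ s < b₁.parLo h₁.κ_pos h₁.seven_le_gapLo neg_one_mem := by
    intro h
    have := b₁.parLo_lt_parHi h₁.κ_pos h₁.seven_le_gapLo h₁.seven_le_gapHi neg_one_mem neg_one_mem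
    linarith
  simp [flipBase, h1, not_le.2 hs]

/-! ### Junction identities -/

/-- **The necked piece function of `b₁` on its upper core is the reflected lower neck of `b₂`**
(level `-αHi₁ s`, `|αHi₁ s| < 7`). [folklore] -/
theorem neckPiece_eq_reflect_railLoPsi (hP : IsFlipPair b₁ b₂) {s : ℝ}
    (hs : s ∈ Icc (b₁.tcHi - b₁.epsHi / 8) (b₁.tcHi + b₁.epsHi / 8)) (hα : |b₁.alphaHi κ s| < 7) :
    b₁.neckPiece κ 1 s = ((reflectLast 3 (psiN.symm (b₂.railLoPsi κ (-b₁.alphaHi κ s))) : 𝕊 3) : 𝔼 4) := by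
  have hκ := h₁.κ_pos
  have hq : κ * (|b₁.alphaHi κ s| + 1) < 8 * κ := by nlinarith
  rw [← b₁.railPtHi_eq_neckPiece hcross₁ hκ h₁.eight_le_poleRad hs hα, railPtHi,
    hP.coe_psiN_symm_railHiPsi_eq hcross₂ hcross₁ hκ (lt_of_lt_of_le hq h₂.eight_le_poleRad) (lt_of_lt_of_le hq h₁.eight_le_poleRad)]

/-- **The necked piece function of `b₁` on its lower core is the reflected upper neck of `b₂`.**
[folklore] -/
theorem neckPiece_eq_reflect_railHiPsi (hP : IsFlipPair b₁ b₂) {s : ℝ}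
    (hs : s ∈ Icc (b₁.tcLo - b₁.epsLo / 8) (b₁.tcLo + b₁.epsLo / 8)) (hα : |b₁.alphaLo κ s| < 7) :
    b₁.neckPiece κ 1 s = ((reflectLast 3 (psiN.symm (b₂.railHiPsi κ (-b₁.alphaLo κ s))) : 𝕊 3) : 𝔼 4) := by
  have hκ := h₁.κ_pos
  have hq : κ * (|b₁.alphaLo κ s| + 1) < 8 * κ := by nlinarith
  rw [← b₁.railPtLo_eq_neckPiece hcross₁ hκ h₁.eight_le_poleRad hs hα, railPtLo,
    hP.coe_psiN_symm_railLoPsi_eq hcross₂ hcross₁ hκ (lt_of_lt_of_le hq h₂.eight_le_poleRad) (lt_of_lt_of_le hq h₁.eight_le_poleRad)]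

/-- **The reflected arc at a lower-core parameter of `b₂` below the chord window is the reflected
lower neck.** [folklore] -/
theorem foreignPt_eq_of_alphaLo_le {u τ : ℝ} (hc : τ ∈ Icc (b₂.tcLo - b₂.epsLo / 8) (b₂.tcLo + b₂.epsLo / 8))
    (hα : b₂.alphaLo κ τ ≤ 5 / 4) :
    foreignPt h₁ h₂ u τ = ((reflectLast 3 (psiN.symm (b₂.railLoPsi κ (b₂.alphaLo κ τ))) : 𝕊 3) : 𝔼 4) := by
  rw [foreignPt, b₂.arcChart_eq_railLoPsi_of_le h₁.κ_pos h₂.seven_le_gapLo h₂.seven_le_gapHi hc hα]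

/-- **The reflected arc at an upper-core parameter of `b₂` with level `≤ 7/2` is the reflected
upper neck.** [folklore] -/
theorem foreignPt_eq_of_alphaHi_le {u τ : ℝ} (hc : τ ∈ Icc (b₂.tcHi - b₂.epsHi / 8) (b₂.tcHi + b₂.epsHi / 8))
    (hα : b₂.alphaHi κ τ ≤ 7 / 2) :
    foreignPt h₁ h₂ u τ = ((reflectLast 3 (psiN.symm (b₂.railHiPsi κ (b₂.alphaHi κ τ))) : 𝕊 3) : 𝔼 4) := by
  rw [foreignPt, b₂.arcChart_eq_railHiPsi_of_le h₁.κ_pos h₂.seven_le_gapLo h₂.seven_le_gapHi hc hα]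

/-- **Late junction**: on `[parHi₁ (-3/4), parHi₁ (-5/4)]` the necked piece function of `b₁` is the
reflected arc through `Θ` (every `u`). [folklore] -/
theorem neckPiece_eq_foreignPt_theta (hP : IsFlipPair b₁ b₂) {u s : ℝ}
    (hs : s ∈ Icc (b₁.parHi h₁.κ_pos h₁.seven_le_gapHi neg_three_quarters_mem) (b₁.parHi h₁.κ_pos h₁.seven_le_gapHi neg_five_quarters_mem)) :
    b₁.neckPiece κ 1 s = foreignPt h₁ h₂ u (theta h₁ h₂ s) := by
  have hκ := h₁.κ_pos
  have h7₁' := h₁.seven_le_gapHi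
  have hlo : b₁.parHi hκ h7₁' neg_half_mem ≤ s := le_trans (b₁.parHi_le_parHi hκ h7₁' neg_three_quarters_mem neg_half_mem (by norm_num)) hs.1
  have hhi : s ≤ b₁.parHi hκ h7₁' neg_five_mem := le_trans hs.2 (b₁.parHi_le_parHi hκ h7₁' neg_five_mem neg_five_quarters_mem (by norm_num))
  have hcore : s ∈ Icc (b₁.tcHi - b₁.epsHi / 8) (b₁.tcHi + b₁.epsHi / 8) :=
    ⟨le_trans (b₁.parHi_mem_core hκ h7₁' neg_half_mem).1 hlo, le_trans hhi (b₁.parHi_mem_core hκ h7₁' neg_five_mem).2⟩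
  have hα1 : b₁.alphaHi κ s ≤ -(3 / 4) := (b₁.alphaHi_le_iff' hκ h7₁' neg_three_quarters_mem hcore).2 hs.1
  have hα2 : -(5 / 4) ≤ b₁.alphaHi κ s := (b₁.le_alphaHi_iff' hκ h7₁' neg_five_quarters_mem hcore).2 hs.2
  have hθ : theta h₁ h₂ s = jc h₁ h₂ s := theta_eq h₁ h₂ ⟨hs.1, by
    have h1 := (b₁.parHi_mem_core hκ h7₁' neg_five_quarters_mem).2
    have h2 := (b₁.parLo_mem_core hκ h₁.seven_le_gapLo neg_three_quarters_mem).1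
    have := b₁.core_marks; linarith [hs.2]⟩
  obtain ⟨hc₂, hlev⟩ := junctionClock_lo b₁ b₂ hκ h₁.seven_le_gapLo h7₁' h₂.seven_le_gapLo h₂.seven_le_gapHi ⟨hlo, hhi⟩
  rw [hθ, jc, foreignPt_eq_of_alphaLo_le h₁ h₂ hc₂ (by rw [hlev]; linarith), hlev,
    neckPiece_eq_reflect_railLoPsi h₁ h₂ hP hcore (abs_lt.2 ⟨by linarith, by linarith⟩)]

/-- **Early junction**: on `[parLo₁ (-7/2), parLo₁ (-3/4)]` the necked piece function of `b₁` is
the reflected arc through `Θ (s + 1)` (every `u`). [folklore] -/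
theorem neckPiece_eq_foreignPt_theta_add_one (hP : IsFlipPair b₁ b₂) {u s : ℝ}
    (hs : s ∈ Icc (b₁.parLo h₁.κ_pos h₁.seven_le_gapLo neg_seven_halves_mem) (b₁.parLo h₁.κ_pos h₁.seven_le_gapLo neg_three_quarters_mem)) :
    b₁.neckPiece κ 1 s = foreignPt h₁ h₂ u (theta h₁ h₂ (s + 1)) := by
  have hκ := h₁.κ_pos
  have h7₁ := h₁.seven_le_gapLo
  have hlo : b₁.parLo hκ h7₁ neg_five_mem ≤ s := le_trans (b₁.parLo_le_parLo hκ h7₁ neg_five_mem neg_seven_halves_mem (by norm_num)) hs.1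
  have hhi : s ≤ b₁.parLo hκ h7₁ neg_half_mem := le_trans hs.2 (b₁.parLo_le_parLo hκ h7₁ neg_three_quarters_mem neg_half_mem (by norm_num))
  have hcore : s ∈ Icc (b₁.tcLo - b₁.epsLo / 8) (b₁.tcLo + b₁.epsLo / 8) :=
    ⟨le_trans (b₁.parLo_mem_core hκ h7₁ neg_five_mem).1 hlo, le_trans hhi (b₁.parLo_mem_core hκ h7₁ neg_half_mem).2⟩
  have hα1 : b₁.alphaLo κ s ≤ -(3 / 4) := (b₁.alphaLo_le_iff' hκ h7₁ neg_three_quarters_mem hcore).2 hs.2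
  have hα2 : -(7 / 2) ≤ b₁.alphaLo κ s := (b₁.le_alphaLo_iff' hκ h7₁ neg_seven_halves_mem hcore).2 hs.1
  have hθ : theta h₁ h₂ (s + 1) = jc h₁ h₂ (s + 1) := theta_eq h₁ h₂ ⟨by
    have h1 := (b₁.parHi_mem_core hκ h₁.seven_le_gapHi neg_three_quarters_mem).2
    have h2 := (b₁.parLo_mem_core hκ h7₁ neg_seven_halves_mem).1
    have := b₁.core_marks; linarith [hs.1], by linarith [hs.2]⟩
  obtain ⟨hc₂, hlev⟩ := junctionClock_hi b₁ b₂ hκ h7₁ h₁.seven_le_gapHi h₂.seven_le_gapLo h₂.seven_le_gapHi (t := s + 1)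
    ⟨by linarith, by linarith⟩
  rw [add_sub_cancel_right] at hlev
  rw [hθ, jc, foreignPt_eq_of_alphaHi_le h₁ h₂ hc₂ (by rw [hlev]; linarith), hlev,
    neckPiece_eq_reflect_railHiPsi h₁ h₂ hP hcore (abs_lt.2 ⟨by linarith, by linarith⟩)]

/-- **The flip frame is the necked piece function of `b₁` on the extended native zone**
`[parLo₁ (-7/2), parHi₁ (-5/4)]`. [folklore] -/
theorem flipBase_eq_neckPiece (hP : IsFlipPair b₁ b₂) {u s : ℝ}
    (hs : s ∈ Icc (b₁.parLo h₁.κ_pos h₁.seven_le_gapLo neg_seven_halves_mem) (b₁.parHi h₁.κ_pos h₁.seven_le_gapHi neg_five_quarters_mem)) :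
    flipBase h₁ h₂ u s = b₁.neckPiece κ 1 s := by
  have hκ := h₁.κ_pos
  rcases lt_or_ge s (b₁.parLo hκ h₁.seven_le_gapLo neg_one_mem) with h1 | h1
  · rw [flipBase_of_lt h₁ h₂ h1]
    exact (neckPiece_eq_foreignPt_theta_add_one h₁ h₂ hP ⟨hs.1,
      h1.le.trans (b₁.parLo_le_parLo hκ h₁.seven_le_gapLo neg_one_mem neg_three_quarters_mem (by norm_num))⟩).symm
  rcases le_or_gt s (b₁.parHi hκ h₁.seven_le_gapHi neg_one_mem) with h2 | h2
  · exact flipBase_of_mem h₁ h₂ ⟨h1, h2⟩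
  · rw [flipBase_of_gt h₁ h₂ h2]
    exact (neckPiece_eq_foreignPt_theta h₁ h₂ hP
      ⟨(b₁.parHi_le_parHi hκ h₁.seven_le_gapHi neg_one_mem neg_three_quarters_mem (by norm_num)).trans h2.le, hs.2⟩).symm

/-- Near a point of the open extended native zone the flip frame is the necked piece function.
[folklore] -/
theorem flipBase_eventuallyEq_neckPiece (hP : IsFlipPair b₁ b₂) (u : ℝ) {s : ℝ}
    (hs : s ∈ Ioo (b₁.parLo h₁.κ_pos h₁.seven_le_gapLo neg_seven_halves_mem) (b₁.parHi h₁.κ_pos h₁.seven_le_gapHi neg_five_quarters_mem)) :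
    flipBase h₁ h₂ u =ᶠ[𝓝 s] b₁.neckPiece κ 1 := by
  filter_upwards [Ioo_mem_nhds hs.1 hs.2] with s' hs' using flipBase_eq_neckPiece h₁ h₂ hP (Ioo_subset_Icc_self hs')

/-- Near a point left of `parLo₁ (-1)` the flip frame is the early foreign formula. [folklore] -/
theorem flipBase_eventuallyEq_early (u : ℝ) {s : ℝ} (hs : s < b₁.parLo h₁.κ_pos h₁.seven_le_gapLo neg_one_mem) :
    flipBase h₁ h₂ u =ᶠ[𝓝 s] fun s ↦ foreignPt h₁ h₂ u (theta h₁ h₂ (s + 1)) := by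
  filter_upwards [Iio_mem_nhds hs] with s' hs' using flipBase_of_lt h₁ h₂ hs'

/-- Near a point right of `parHi₁ (-1)` the flip frame is the late foreign formula. [folklore] -/
theorem flipBase_eventuallyEq_late (u : ℝ) {s : ℝ} (hs : b₁.parHi h₁.κ_pos h₁.seven_le_gapHi neg_one_mem < s) :
    flipBase h₁ h₂ u =ᶠ[𝓝 s] fun s ↦ foreignPt h₁ h₂ u (theta h₁ h₂ s) := by
  filter_upwards [Ioi_mem_nhds hs] with s' hs' using flipBase_of_gt h₁ h₂ hs'

/-! ### Smoothness -/

/-- **The reflected arc along a `C^∞` parameter map with values in the smooth arc domain is jointly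
`C^∞`.** [folklore] -/
theorem contDiff_foreignPt_comp {φ : ℝ → ℝ} (hφ : ContDiff ℝ ∞ φ)
    (hmem : ∀ s, φ s ∈ Ioo (b₂.parLo h₁.κ_pos h₂.seven_le_gapLo neg_seven_mem) (b₂.parHi h₁.κ_pos h₂.seven_le_gapHi neg_seven_mem)) :
    ContDiff ℝ ∞ (fun p : ℝ × ℝ ↦ foreignPt h₁ h₂ p.1 (φ p.2)) := by
  have key : (fun p : ℝ × ℝ ↦ foreignPt h₁ h₂ p.1 (φ p.2)) =
      (fun y : 𝔼 3 ↦ ((reflectLast 3 (psiN.symm y) : 𝕊 3) : 𝔼 4)) ∘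
        (uncurry (b₂.arcChart h₁.κ_pos h₂.seven_le_gapLo h₂.seven_le_gapHi) ∘ fun q : ℝ × ℝ ↦ (q.1, φ q.2)) := rfl
  rw [key, contDiff_iff_contDiffAt]
  intro p
  have ha := b₂.contDiffAt_arcChart hcross₂ h₁.κ_pos h₂.seven_le_gapLo h₂.seven_le_gapHi h₂.nine_le_poleRad (u := p.1) (hmem p.2)
  have hin : ContDiffAt ℝ ∞ (fun q : ℝ × ℝ ↦ (q.1, φ q.2)) p := (contDiffAt_fst.prodMk (hφ.contDiffAt.comp p contDiffAt_snd))
  exact contDiff_coe_reflectLast_psiN_symm.contDiffAt.comp p (ContDiffAt.comp (f := fun q : ℝ × ℝ ↦ (q.1, φ q.2)) p ha hin)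

/-- The early foreign formula is jointly `C^∞`. [folklore] -/
theorem contDiff_early : ContDiff ℝ ∞ (fun p : ℝ × ℝ ↦ foreignPt h₁ h₂ p.1 (theta h₁ h₂ (p.2 + 1))) :=
  contDiff_foreignPt_comp h₁ h₂ (φ := fun s ↦ theta h₁ h₂ (s + 1)) ((contDiff_theta h₁ h₂).comp (contDiff_id.add contDiff_const))
    fun s ↦ theta_mem_Ioo h₁ h₂ (s + 1)

/-- The late foreign formula is jointly `C^∞`. [folklore] -/
theorem contDiff_late : ContDiff ℝ ∞ (fun p : ℝ × ℝ ↦ foreignPt h₁ h₂ p.1 (theta h₁ h₂ p.2)) :=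
  contDiff_foreignPt_comp h₁ h₂ (φ := theta h₁ h₂) (contDiff_theta h₁ h₂) fun s ↦ theta_mem_Ioo h₁ h₂ s

omit h₂ in
/-- The marks `parLo₁ (-7/2) < parLo₁ (-1)` and `parHi₁ (-1) < parHi₁ (-5/4)`. [folklore] -/
theorem zone_marks :
    b₁.parLo h₁.κ_pos h₁.seven_le_gapLo neg_seven_halves_mem < b₁.parLo h₁.κ_pos h₁.seven_le_gapLo neg_one_mem ∧
      b₁.parHi h₁.κ_pos h₁.seven_le_gapHi neg_one_mem < b₁.parHi h₁.κ_pos h₁.seven_le_gapHi neg_five_quarters_mem :=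
  ⟨b₁.parLo_lt_parLo h₁.κ_pos h₁.seven_le_gapLo neg_seven_halves_mem neg_one_mem (by norm_num),
    b₁.parHi_lt_parHi h₁.κ_pos h₁.seven_le_gapHi neg_five_quarters_mem neg_one_mem (by norm_num)⟩

/-- **The flip frame is jointly `C^∞`.** [folklore] -/
theorem contDiff_flipBase (hP : IsFlipPair b₁ b₂) : ContDiff ℝ ∞ (uncurry (flipBase h₁ h₂)) := by
  obtain ⟨m1, m2⟩ := zone_marks h₁
  rw [contDiff_iff_contDiffAt]
  rintro ⟨u, s⟩
  rcases le_or_gt s (b₁.parLo h₁.κ_pos h₁.seven_le_gapLo neg_seven_halves_mem) with hs1 | hs1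
  · have hev : uncurry (flipBase h₁ h₂) =ᶠ[𝓝 (u, s)] fun p : ℝ × ℝ ↦ foreignPt h₁ h₂ p.1 (theta h₁ h₂ (p.2 + 1)) := by
      filter_upwards [prod_mem_nhds univ_mem (Iio_mem_nhds (lt_of_le_of_lt hs1 m1))] with p hp
      exact flipBase_of_lt h₁ h₂ hp.2
    exact (contDiff_early h₁ h₂).contDiffAt.congr_of_eventuallyEq hev
  rcases lt_or_ge s (b₁.parHi h₁.κ_pos h₁.seven_le_gapHi neg_five_quarters_mem) with hs2 | hs2
  · have hev : uncurry (flipBase h₁ h₂) =ᶠ[𝓝 (u, s)] fun p : ℝ × ℝ ↦ b₁.neckPiece κ 1 p.2 := by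
      filter_upwards [prod_mem_nhds univ_mem (Ioo_mem_nhds hs1 hs2)] with p hp
      exact flipBase_eq_neckPiece h₁ h₂ hP (Ioo_subset_Icc_self hp.2)
    exact ((b₁.contDiff_neckPiece κ).comp (contDiff_const.prodMk contDiff_snd)).contDiffAt.congr_of_eventuallyEq hev
  · have hev : uncurry (flipBase h₁ h₂) =ᶠ[𝓝 (u, s)] fun p : ℝ × ℝ ↦ foreignPt h₁ h₂ p.1 (theta h₁ h₂ p.2) := by
      filter_upwards [prod_mem_nhds univ_mem (Ioi_mem_nhds (lt_of_lt_of_le m2 hs2))] with p hp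
      exact flipBase_of_gt h₁ h₂ hp.2
    exact (contDiff_late h₁ h₂).contDiffAt.congr_of_eventuallyEq hev

/-- Each loop of the flip frame is `C^∞`. [folklore] -/
theorem contDiff_flipBase_right (hP : IsFlipPair b₁ b₂) (u : ℝ) : ContDiff ℝ ∞ (flipBase h₁ h₂ u) :=
  (contDiff_flipBase h₁ h₂ hP).comp (contDiff_const.prodMk contDiff_id)

/-! ### Seam, norm -/

omit h₂ in
/-- The seam window lies left of `parLo₁ (-1)` and, shifted by one, right of `parHi₁ (-1)`.
[folklore] -/
theorem seam_marks {t : ℝ} (ht : t ∈ Ioo (b₁.alo - b₁.seamEps) (b₁.alo + b₁.seamEps)) :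
    t < b₁.parLo h₁.κ_pos h₁.seven_le_gapLo neg_one_mem ∧ b₁.parHi h₁.κ_pos h₁.seven_le_gapHi neg_one_mem < t + 1 := by
  have hs := b₁.seamEps_bounds
  have h1 := (b₁.parLo_mem_core h₁.κ_pos h₁.seven_le_gapLo neg_one_mem).1
  have h2 := (b₁.parHi_mem_core h₁.κ_pos h₁.seven_le_gapHi neg_one_mem).2
  have := b₁.core_marks
  obtain ⟨hw1, -, hε⟩ := b₁.tcLo_window
  obtain ⟨-, hw4, hε'⟩ := b₁.tcHi_window
  constructor
  · linarith [ht.2]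
  · linarith [ht.1, hs.2.2.2]

/-- **The flip frame has the seam property.** [folklore] -/
theorem flipBase_seam (u : ℝ) : ∀ t ∈ Ioo (b₁.alo - b₁.seamEps) (b₁.alo + b₁.seamEps), flipBase h₁ h₂ u (t + 1) = flipBase h₁ h₂ u t := by
  intro t ht
  obtain ⟨h1, h2⟩ := seam_marks h₁ ht
  rw [flipBase_of_lt h₁ h₂ h1, flipBase_of_gt h₁ h₂ h2]

/-- The flip frame is a unit vector. [folklore] -/
theorem norm_flipBase (u s : ℝ) : ‖flipBase h₁ h₂ u s‖ = 1 := by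
  rcases lt_or_ge s (b₁.parLo h₁.κ_pos h₁.seven_le_gapLo neg_one_mem) with h1 | h1
  · rw [flipBase_of_lt h₁ h₂ h1]; exact norm_foreignPt h₁ h₂ _ _
  rcases le_or_gt s (b₁.parHi h₁.κ_pos h₁.seven_le_gapHi neg_one_mem) with h2 | h2
  · rw [flipBase_of_mem h₁ h₂ ⟨h1, h2⟩]; exact b₁.norm_neckPiece _ _ _
  · rw [flipBase_of_gt h₁ h₂ h2]; exact norm_foreignPt h₁ h₂ _ _

/-! ### Regularity -/

/-- **The reflected arc along a parameter map with nonzero derivative is regular** (`u ∈ [0, 1]`,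
value in the smooth arc domain). [folklore] -/
theorem deriv_foreignPt_comp_ne_zero {φ : ℝ → ℝ} {φ' s u : ℝ} (hφ : HasDerivAt φ φ' s) (hφ' : φ' ≠ 0) (hu : u ∈ Icc (0 : ℝ) 1)
    (hmem : φ s ∈ Ioo (b₂.parLo h₁.κ_pos h₂.seven_le_gapLo neg_seven_mem) (b₂.parHi h₁.κ_pos h₂.seven_le_gapHi neg_seven_mem)) :
    deriv (fun s ↦ foreignPt h₁ h₂ u (φ s)) s ≠ 0 := by
  have hκ := h₁.κ_pos
  have hd : HasDerivAt (b₂.arcChart hκ h₂.seven_le_gapLo h₂.seven_le_gapHi u)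
      (deriv (b₂.arcChart hκ h₂.seven_le_gapLo h₂.seven_le_gapHi u) (φ s)) (φ s) :=
    ((b₂.contDiffAt_arcChart_right hcross₂ hκ h₂.seven_le_gapLo h₂.seven_le_gapHi h₂.nine_le_poleRad u hmem).differentiableAt
      (by simp)).hasDerivAt
  have hne := b₂.deriv_arcChart_ne_zero hκ h₂.seven_le_gapLo h₂.seven_le_gapHi h₂.flat h₂.nine_lt_r h₂.good h₂.eps_lt_one hu hmem
  have hcomp : HasDerivAt (fun s ↦ b₂.arcChart hκ h₂.seven_le_gapLo h₂.seven_le_gapHi u (φ s))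
      (φ' • deriv (b₂.arcChart hκ h₂.seven_le_gapLo h₂.seven_le_gapHi u) (φ s)) s :=
    HasDerivAt.scomp (g₁ := b₂.arcChart hκ h₂.seven_le_gapLo h₂.seven_le_gapHi u) (h := φ) s hd hφ
  exact deriv_coe_reflectLast_psiN_symm_comp_ne_zero hcomp (smul_ne_zero hφ' hne)

/-- **`Θ` has positive derivative** on the open clamp-identity zone. [folklore] -/
theorem hasDerivAt_theta {t : ℝ} (ht : t ∈ Ioo (b₁.parHi h₁.κ_pos h₁.seven_le_gapHi neg_three_quarters_mem)
    (b₁.parLo h₁.κ_pos h₁.seven_le_gapLo neg_three_quarters_mem + 1)) :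
    HasDerivAt (theta h₁ h₂) (deriv (jc h₁ h₂) t) t ∧ 0 < deriv (jc h₁ h₂) t := by
  have hκ := h₁.κ_pos
  have hev : theta h₁ h₂ =ᶠ[𝓝 t] jc h₁ h₂ := by
    filter_upwards [Ioo_mem_nhds ht.1 ht.2] with s hs using theta_eq h₁ h₂ (Ioo_subset_Icc_self hs)
  have hjd : HasDerivAt (jc h₁ h₂) (deriv (jc h₁ h₂) t) t :=
    (((contDiff_junctionClock b₁ b₂ hκ h₁.seven_le_gapLo h₁.seven_le_gapHi h₂.seven_le_gapLo h₂.seven_le_gapHi).differentiable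
      (by simp)) t).hasDerivAt
  refine ⟨hjd.congr_of_eventuallyEq hev, ?_⟩
  exact deriv_junctionClock_pos b₁ b₂ hκ h₁.seven_le_gapLo h₁.seven_le_gapHi h₂.seven_le_gapLo h₂.seven_le_gapHi
    ⟨(b₁.parHi_le_parHi hκ h₁.seven_le_gapHi neg_three_quarters_mem neg_half_mem (by norm_num)).trans ht.1.le,
      ht.2.le.trans (by linarith [b₁.parLo_le_parLo hκ h₁.seven_le_gapLo neg_three_quarters_mem neg_half_mem (by norm_num)])⟩

/-- **The flip frame is regular on `[alo₁ - seamEps, alo₁ + 1 + seamEps)`** (`u ∈ [0, 1]`).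
[folklore] -/
theorem deriv_flipBase_ne_zero (hP : IsFlipPair b₁ b₂) {u : ℝ} (hu : u ∈ Icc (0 : ℝ) 1) {s : ℝ}
    (hs : s ∈ Ico (b₁.alo - b₁.seamEps) (b₁.alo + 1 + b₁.seamEps)) : deriv (flipBase h₁ h₂ u) s ≠ 0 := by
  have hκ := h₁.κ_pos
  obtain ⟨m1, m2⟩ := zone_marks h₁
  have hsb := b₁.seamEps_bounds
  have hcm := b₁.core_marks
  obtain ⟨hw1, -, hε⟩ := b₁.tcLo_window
  obtain ⟨-, hw4, hε'⟩ := b₁.tcHi_window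
  have hm := b₁.marks_lt
  rcases le_or_gt s (b₁.parLo hκ h₁.seven_le_gapLo neg_seven_halves_mem) with hs1 | hs1
  · -- early foreign zone
    rw [(flipBase_eventuallyEq_early h₁ h₂ u (lt_of_le_of_lt hs1 m1)).deriv_eq]
    have hz : s + 1 ∈ Ioo (b₁.parHi hκ h₁.seven_le_gapHi neg_three_quarters_mem) (b₁.parLo hκ h₁.seven_le_gapLo neg_three_quarters_mem + 1) := by
      have h1 := (b₁.parHi_mem_core hκ h₁.seven_le_gapHi neg_three_quarters_mem).2
      constructor
      · linarith [hs.1]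
      · linarith [b₁.parLo_lt_parLo hκ h₁.seven_le_gapLo neg_seven_halves_mem neg_three_quarters_mem (by norm_num)]
    obtain ⟨hθ, hpos⟩ := hasDerivAt_theta h₁ h₂ hz
    have hθ' : HasDerivAt (fun s ↦ theta h₁ h₂ (s + 1)) (deriv (jc h₁ h₂) (s + 1) * 1) s :=
      HasDerivAt.comp (h₂ := theta h₁ h₂) (h := fun s : ℝ ↦ s + 1) s hθ ((hasDerivAt_id s).add_const 1)
    exact deriv_foreignPt_comp_ne_zero h₁ h₂ hθ' (by rw [mul_one]; exact hpos.ne') hu (theta_mem_Ioo h₁ h₂ _)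
  rcases lt_or_ge s (b₁.parHi hκ h₁.seven_le_gapHi neg_five_quarters_mem) with hs2 | hs2
  · -- extended native zone
    rw [(flipBase_eventuallyEq_neckPiece h₁ h₂ hP u ⟨hs1, hs2⟩).deriv_eq]
    have hIco : s ∈ Ico b₁.alo (b₁.alo + 1) := by
      have h1 := (b₁.parLo_mem_core hκ h₁.seven_le_gapLo neg_seven_halves_mem).1
      have h2 := (b₁.parHi_mem_core hκ h₁.seven_le_gapHi neg_five_quarters_mem).2
      exact ⟨by linarith, by linarith⟩
    exact (b₁.isRegularLoop_neckLoop h₁.κ_le_quarter hκ ⟨zero_le_one, le_rfl⟩).deriv_ne_zero_of_mem hsb.1 (b₁.neckPiece_seam κ) hIco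
  · -- late foreign zone
    rw [(flipBase_eventuallyEq_late h₁ h₂ u (lt_of_lt_of_le m2 hs2)).deriv_eq]
    have hz : s ∈ Ioo (b₁.parHi hκ h₁.seven_le_gapHi neg_three_quarters_mem) (b₁.parLo hκ h₁.seven_le_gapLo neg_three_quarters_mem + 1) := by
      have h2 := (b₁.parLo_mem_core hκ h₁.seven_le_gapLo neg_three_quarters_mem).1
      constructor
      · linarith [b₁.parHi_lt_parHi hκ h₁.seven_le_gapHi neg_five_quarters_mem neg_three_quarters_mem (by norm_num)]
      · linarith [hs.2]
    obtain ⟨hθ, hpos⟩ := hasDerivAt_theta h₁ h₂ hz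
    exact deriv_foreignPt_comp_ne_zero h₁ h₂ hθ hpos.ne' hu (theta_mem_Ioo h₁ h₂ _)

/-- **The periodised flip frame is a regular loop** (`u ∈ [0, 1]`). [folklore] -/
theorem isRegularLoop_flipBase (hP : IsFlipPair b₁ b₂) {u : ℝ} (hu : u ∈ Icc (0 : ℝ) 1) :
    IsRegularLoop (periodise b₁.alo (flipBase h₁ h₂ u)) :=
  isRegularLoop_periodise (contDiff_flipBase_right h₁ h₂ hP u) b₁.seamEps_bounds.1 (flipBase_seam h₁ h₂ u)
    (fun t _ ↦ norm_flipBase h₁ h₂ u t)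
    (fun t ht ↦ deriv_flipBase_ne_zero h₁ h₂ hP hu ⟨by linarith [ht.1, b₁.seamEps_bounds.1], by linarith [ht.2, b₁.seamEps_bounds.1]⟩)

/-! ### Hemispheres -/

/-- **The middle of the circle of `b₁` is in the open southern hemisphere**: for
`s ∈ (tcLo₁, tcHi₁)` the flip frame (the necked piece function) has negative last coordinate
(`B₁` south). [folklore] -/
theorem flipBase_last_neg (hP : IsFlipPair b₁ b₂) (hB₁ : B₁.InSouth) (u : ℝ) {s : ℝ} (hs : s ∈ Ioo b₁.tcLo b₁.tcHi) :
    flipBase h₁ h₂ u s (Fin.last 3) < 0 := by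
  have hκ := h₁.κ_pos
  have hcm := b₁.core_marks
  obtain ⟨hw1, hw2, hε⟩ := b₁.tcLo_window
  obtain ⟨hw3, hw4, hε'⟩ := b₁.tcHi_window
  have hz : s ∈ Icc (b₁.parLo hκ h₁.seven_le_gapLo neg_seven_halves_mem) (b₁.parHi hκ h₁.seven_le_gapHi neg_five_quarters_mem) := by
    have h1 : b₁.parLo hκ h₁.seven_le_gapLo neg_seven_halves_mem ≤ b₁.tcLo := by
      rw [← b₁.parLo_zero hκ h₁.seven_le_gapLo]; exact b₁.parLo_le_parLo hκ h₁.seven_le_gapLo neg_seven_halves_mem _ (by norm_num)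
    have h2 : b₁.tcHi ≤ b₁.parHi hκ h₁.seven_le_gapHi neg_five_quarters_mem := by
      rw [← b₁.parHi_zero hκ h₁.seven_le_gapHi]; exact b₁.parHi_le_parHi hκ h₁.seven_le_gapHi neg_five_quarters_mem _ (by norm_num)
    exact ⟨by linarith [hs.1], by linarith [hs.2]⟩
  rw [flipBase_eq_neckPiece h₁ h₂ hP hz]
  rcases le_or_gt s (b₁.tcLo + b₁.epsLo / 8) with h1 | h1
  · -- right half of the lower core: the band point `(χ₁ s, 1/2 - κ)` with `χ₁ s > 1/2`
    have hc : s ∈ Icc (b₁.tcLo - b₁.epsLo / 8) (b₁.tcLo + b₁.epsLo / 8) := ⟨by linarith [hs.1], h1⟩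
    rw [b₁.neckPiece_coreLo hc]
    have hα : 0 < b₁.alphaLo κ s := by
      rw [← b₁.alphaLo_tcLo κ]
      exact b₁.strictMonoOn_alphaLo hκ ⟨by linarith, by linarith⟩ hc hs.1
    have hχ : 2⁻¹ < b₁.chiLo s := by have := b₁.mul_alphaLo hκ.ne' s; nlinarith
    have hmem : (pt2 (b₁.chiLo s) (1 / 2 - κ) : 𝔼 2) ∈ squareNhd b₁.δ := by
      rw [← b₁.neckLo_core hc]
      exact (b₁.neckLo_mem h₁.κ_le_quarter hκ ⟨zero_le_one, le_rfl⟩ ⟨by linarith [hc.1], by linarith [hc.2]⟩).1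
    exact b₁.band_last_neg_of_half_lt hB₁ hcross₁ hmem (by simpa using hχ)
  rcases lt_or_ge s (b₁.tcHi - b₁.epsHi / 8) with h2 | h2
  · -- the middle: far southern set
    have hg : 0 < min b₁.gapLo b₁.gapHi := lt_min b₁.gapLo_pos b₁.gapHi_pos
    obtain ⟨x, hx, he⟩ := b₁.spikePiece_one_mem_farSouth_middle h₁ le_rfl ⟨h1, h2⟩
    rw [b₁.spikePiece_one_of_not_core h₁ (fun hc ↦ by linarith [hc.2]) (fun hc ↦ by linarith [hc.1])] at he
    rw [he]
    exact b₁.farSouth_last_neg hcross₁ hB₁ hg hx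
  · -- left half of the upper core
    have hc : s ∈ Icc (b₁.tcHi - b₁.epsHi / 8) (b₁.tcHi + b₁.epsHi / 8) := ⟨h2, by linarith [hs.2]⟩
    rw [b₁.neckPiece_coreHi hc]
    have hα : 0 < b₁.alphaHi κ s := by
      rw [← b₁.alphaHi_tcHi κ]
      exact b₁.strictAntiOn_alphaHi hκ hc ⟨by linarith, by linarith⟩ hs.2
    have hχ : 2⁻¹ < b₁.chiHi s := by have := b₁.mul_alphaHi hκ.ne' s; nlinarith
    have hmem : (pt2 (b₁.chiHi s) (1 / 2 + κ) : 𝔼 2) ∈ squareNhd b₁.δ := by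
      rw [← b₁.neckUp_core hc]
      exact (b₁.neckUp_mem h₁.κ_le_quarter hκ ⟨zero_le_one, le_rfl⟩ ⟨by linarith [hc.1], by linarith [hc.2]⟩).1
    exact b₁.band_last_neg_of_half_lt hB₁ hcross₁ hmem (by simpa using hχ)

/-- **A reflected deep-arc point at a parameter strictly between the core centres of `b₂` is in
the open northern hemisphere** (`B₂` south, `u ∈ [0, 1]`). [folklore] -/
theorem foreignPt_last_pos (hB₂ : B₂.InSouth) {u : ℝ} (hu : u ∈ Icc (0 : ℝ) 1) {τ : ℝ} (hτ : τ ∈ Ioo b₂.tcLo b₂.tcHi)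
    (hτ' : τ ≤ b₂.parHi h₁.κ_pos h₂.seven_le_gapHi neg_seven_mem) : 0 < foreignPt h₁ h₂ u τ (Fin.last 3) := by
  rw [foreignPt, reflectLast_apply_last, neg_pos]
  exact b₂.coe_psiN_symm_arcChart_last_neg hcross₂ h₁.κ_pos h₂.seven_le_gapLo h₂.seven_le_gapHi hB₂ h₂.nine_lt_half hu hτ hτ'

/-- `Θ` values lie strictly between the core centres of `b₂` and left of `parHi₂ (-7)`. [folklore] -/
theorem theta_mem_Ioo_centres (t : ℝ) :
    theta h₁ h₂ t ∈ Ioo b₂.tcLo b₂.tcHi ∧ theta h₁ h₂ t ≤ b₂.parHi h₁.κ_pos h₂.seven_le_gapHi neg_seven_mem := by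
  have hκ := h₁.κ_pos
  have h := theta_mem h₁ h₂ t
  refine ⟨⟨?_, ?_⟩, h.2.trans (b₂.parHi_le_parHi hκ h₂.seven_le_gapHi neg_seven_mem half_mem (by norm_num))⟩
  · have : b₂.tcLo < b₂.parLo hκ h₂.seven_le_gapLo half_mem := by
      rw [← b₂.parLo_zero hκ h₂.seven_le_gapLo]; exact b₂.parLo_lt_parLo hκ h₂.seven_le_gapLo _ half_mem (by norm_num)
    linarith [h.1]
  · have : b₂.parHi hκ h₂.seven_le_gapHi half_mem < b₂.tcHi := by
      rw [← b₂.parHi_zero hκ h₂.seven_le_gapHi]; exact b₂.parHi_lt_parHi hκ h₂.seven_le_gapHi _ half_mem (by norm_num)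
    linarith [h.2]

/-- **Off the middle the flip frame is in the closed northern hemisphere** (`A₁` north, `B₂` south,
`u ∈ [0, 1]`): `s ∈ [alo₁, alo₁ + 1) \ (tcLo₁, tcHi₁)`. [folklore] -/
theorem flipBase_last_nonneg (hA₁ : A₁.InNorth) (hB₂ : B₂.InSouth) {u : ℝ} (hu : u ∈ Icc (0 : ℝ) 1)
    {s : ℝ} (hs' : s ∉ Ioo b₁.tcLo b₁.tcHi) : 0 ≤ flipBase h₁ h₂ u s (Fin.last 3) := by
  have hκ := h₁.κ_pos
  have hcm := b₁.core_marks
  obtain ⟨hw1, hw2, hε⟩ := b₁.tcLo_window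
  obtain ⟨hw3, hw4, hε'⟩ := b₁.tcHi_window
  rcases lt_or_ge s (b₁.parLo hκ h₁.seven_le_gapLo neg_one_mem) with h1 | h1
  · rw [flipBase_of_lt h₁ h₂ h1]
    obtain ⟨hm, hm'⟩ := theta_mem_Ioo_centres h₁ h₂ (s + 1)
    exact (foreignPt_last_pos h₁ h₂ hB₂ hu hm hm').le
  rcases le_or_gt s (b₁.parHi hκ h₁.seven_le_gapHi neg_one_mem) with h2 | h2
  · rw [flipBase_of_mem h₁ h₂ ⟨h1, h2⟩]
    rcases le_or_gt s b₁.tcLo with h3 | h3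
    · -- lower core, level in `[-1, 0]`
      have hc : s ∈ Icc (b₁.tcLo - b₁.epsLo / 8) (b₁.tcLo + b₁.epsLo / 8) :=
        ⟨(b₁.parLo_mem_core hκ h₁.seven_le_gapLo neg_one_mem).1.trans h1, by linarith⟩
      rw [b₁.neckPiece_coreLo hc]
      have hχ : b₁.chiLo s ≤ 2⁻¹ := by have := b₁.monotone_chiLo h3; rw [b₁.chiLo_tcLo] at this; linarith
      have hmem : (pt2 (b₁.chiLo s) (1 / 2 - κ) : 𝔼 2) ∈ squareNhd b₁.δ := by
        rw [← b₁.neckLo_core hc]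
        exact (b₁.neckLo_mem h₁.κ_le_quarter hκ ⟨zero_le_one, le_rfl⟩ ⟨by linarith [hc.1], by linarith [hc.2]⟩).1
      exact b₁.band_last_nonneg_of_le_half hcross₁ hA₁ hmem (by simpa using hχ)
    · have h4 : b₁.tcHi ≤ s := by
        by_contra h4; exact hs' ⟨h3, not_le.1 h4⟩
      have hc : s ∈ Icc (b₁.tcHi - b₁.epsHi / 8) (b₁.tcHi + b₁.epsHi / 8) :=
        ⟨by linarith, h2.trans (b₁.parHi_mem_core hκ h₁.seven_le_gapHi neg_one_mem).2⟩
      rw [b₁.neckPiece_coreHi hc]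
      have hχ : b₁.chiHi s ≤ 2⁻¹ := by have := b₁.antitone_chiHi h4; rw [b₁.chiHi_tcHi] at this; linarith
      have hmem : (pt2 (b₁.chiHi s) (1 / 2 + κ) : 𝔼 2) ∈ squareNhd b₁.δ := by
        rw [← b₁.neckUp_core hc]
        exact (b₁.neckUp_mem h₁.κ_le_quarter hκ ⟨zero_le_one, le_rfl⟩ ⟨by linarith [hc.1], by linarith [hc.2]⟩).1
      exact b₁.band_last_nonneg_of_le_half hcross₁ hA₁ hmem (by simpa using hχ)
  · rw [flipBase_of_gt h₁ h₂ h2]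
    obtain ⟨hm, hm'⟩ := theta_mem_Ioo_centres h₁ h₂ s
    exact (foreignPt_last_pos h₁ h₂ hB₂ hu hm hm').le

/-! ### The parameter map of the northern part and injectivity -/

/-- **The arc parameter of the northern part**, on the unrolled interval `[tcHi₁, tcLo₁ + 1]`: the
lower-core parameter of `b₂` at level `-αHi₁ τ` up to `parHi₁ (-1)`, the junction clock up to
`parLo₁ (-1) + 1`, the upper-core parameter of `b₂` at level `-αLo₁ (τ - 1)` after. [folklore] -/
def northParam (τ : ℝ) : ℝ :=
  if τ ≤ b₁.parHi h₁.κ_pos h₁.seven_le_gapHi neg_one_mem then levLo b₂ κ (-b₁.alphaHi κ τ)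
  else if τ < b₁.parLo h₁.κ_pos h₁.seven_le_gapLo neg_one_mem + 1 then jc h₁ h₂ τ
  else levHi b₂ κ (-b₁.alphaLo κ (τ - 1))

omit h₂ in
/-- Levels on the first piece: `-αHi₁ τ ∈ [0, 1]` for `τ ∈ [tcHi₁, parHi₁ (-1)]`. [folklore] -/
theorem neg_alphaHi_mem {τ : ℝ} (hτ : τ ∈ Icc b₁.tcHi (b₁.parHi h₁.κ_pos h₁.seven_le_gapHi neg_one_mem)) :
    -b₁.alphaHi κ τ ∈ Icc (0 : ℝ) 1 := by
  have hκ := h₁.κ_pos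
  have hε' := b₁.epsHi_bounds.1
  have hc : τ ∈ Icc (b₁.tcHi - b₁.epsHi / 8) (b₁.tcHi + b₁.epsHi / 8) :=
    ⟨by linarith [hτ.1], hτ.2.trans (b₁.parHi_mem_core hκ h₁.seven_le_gapHi neg_one_mem).2⟩
  constructor
  · have : b₁.alphaHi κ τ ≤ b₁.alphaHi κ b₁.tcHi :=
      (b₁.strictAntiOn_alphaHi hκ).antitoneOn ⟨by linarith, by linarith⟩ hc hτ.1
    rw [b₁.alphaHi_tcHi] at this; linarith
  · have := (b₁.le_alphaHi_iff' hκ h₁.seven_le_gapHi neg_one_mem hc).2 hτ.2; linarith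

omit h₂ in
/-- Levels on the third piece: `-αLo₁ (τ - 1) ∈ [0, 1]` for `τ ∈ [parLo₁ (-1) + 1, tcLo₁ + 1]`.
[folklore] -/
theorem neg_alphaLo_mem {τ : ℝ} (hτ : τ ∈ Icc (b₁.parLo h₁.κ_pos h₁.seven_le_gapLo neg_one_mem + 1) (b₁.tcLo + 1)) :
    -b₁.alphaLo κ (τ - 1) ∈ Icc (0 : ℝ) 1 := by
  have hκ := h₁.κ_pos
  have hε := b₁.epsLo_bounds.1
  have hc : τ - 1 ∈ Icc (b₁.tcLo - b₁.epsLo / 8) (b₁.tcLo + b₁.epsLo / 8) :=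
    ⟨by linarith [hτ.1, (b₁.parLo_mem_core hκ h₁.seven_le_gapLo neg_one_mem).1], by linarith [hτ.2]⟩
  constructor
  · have : b₁.alphaLo κ (τ - 1) ≤ b₁.alphaLo κ b₁.tcLo :=
      (b₁.strictMonoOn_alphaLo hκ).monotoneOn hc ⟨by linarith, by linarith⟩ (by linarith [hτ.2])
    rw [b₁.alphaLo_tcLo] at this; linarith
  · have := (b₁.le_alphaLo_iff' hκ h₁.seven_le_gapLo neg_one_mem hc).2 (by linarith [hτ.1]); linarith

/-- The parameter map on the first piece. [folklore] -/
theorem northParam_of_le {τ : ℝ} (hτ : τ ∈ Icc b₁.tcHi (b₁.parHi h₁.κ_pos h₁.seven_le_gapHi neg_one_mem)) :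
    northParam h₁ h₂ τ = b₂.parLo h₁.κ_pos h₂.seven_le_gapLo (mem7_of_mem01 (neg_alphaHi_mem h₁ hτ)) := by
  rw [northParam, if_pos hτ.2, levLo_eq_parLo h₁.κ_pos b₂ h₂.seven_le_gapLo]

/-- The parameter map on the middle piece. [folklore] -/
theorem northParam_of_mem {τ : ℝ} (hτ : τ ∈ Ioo (b₁.parHi h₁.κ_pos h₁.seven_le_gapHi neg_one_mem) (b₁.parLo h₁.κ_pos h₁.seven_le_gapLo neg_one_mem + 1)) :
    northParam h₁ h₂ τ = jc h₁ h₂ τ := by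
  rw [northParam, if_neg (not_le.2 hτ.1), if_pos hτ.2]

/-- The parameter map on the third piece. [folklore] -/
theorem northParam_of_ge {τ : ℝ} (hτ : τ ∈ Icc (b₁.parLo h₁.κ_pos h₁.seven_le_gapLo neg_one_mem + 1) (b₁.tcLo + 1)) :
    northParam h₁ h₂ τ = b₂.parHi h₁.κ_pos h₂.seven_le_gapHi (mem7_of_mem01 (neg_alphaLo_mem h₁ hτ)) := by
  have hκ := h₁.κ_pos
  have h1 : ¬ τ ≤ b₁.parHi hκ h₁.seven_le_gapHi neg_one_mem := by
    have := (b₁.parHi_mem_core hκ h₁.seven_le_gapHi neg_one_mem).2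
    have := (b₁.parLo_mem_core hκ h₁.seven_le_gapLo neg_one_mem).1
    have := b₁.core_marks
    intro h; linarith [hτ.1]
  rw [northParam, if_neg h1, if_neg (not_lt.2 hτ.1), levHi_eq_parHi h₁.κ_pos b₂ h₂.seven_le_gapHi]

omit h₂ in
/-- Ordering of the marks of the unrolled interval. [folklore] -/
theorem unroll_marks :
    b₁.tcHi ≤ b₁.parHi h₁.κ_pos h₁.seven_le_gapHi neg_one_mem ∧
      b₁.parHi h₁.κ_pos h₁.seven_le_gapHi neg_one_mem < b₁.alo + 1 ∧
      b₁.alo + 1 < b₁.parLo h₁.κ_pos h₁.seven_le_gapLo neg_one_mem + 1 ∧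
      b₁.parLo h₁.κ_pos h₁.seven_le_gapLo neg_one_mem ≤ b₁.tcLo := by
  have hκ := h₁.κ_pos
  have hcm := b₁.core_marks
  refine ⟨?_, ?_, ?_, ?_⟩
  · rw [← b₁.parHi_zero hκ h₁.seven_le_gapHi]; exact b₁.parHi_le_parHi hκ h₁.seven_le_gapHi neg_one_mem _ (by norm_num)
  · linarith [(b₁.parHi_mem_core hκ h₁.seven_le_gapHi neg_one_mem).2]
  · linarith [(b₁.parLo_mem_core hκ h₁.seven_le_gapLo neg_one_mem).1]
  · rw [← b₁.parLo_zero hκ h₁.seven_le_gapLo]; exact b₁.parLo_le_parLo hκ h₁.seven_le_gapLo neg_one_mem _ (by norm_num)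

/-- The junction clock at the two junctions. [folklore] -/
theorem jc_junctions :
    jc h₁ h₂ (b₁.parHi h₁.κ_pos h₁.seven_le_gapHi neg_one_mem) = b₂.parLo h₁.κ_pos h₂.seven_le_gapLo (v := 1) ⟨by norm_num, by norm_num⟩ ∧
      jc h₁ h₂ (b₁.parLo h₁.κ_pos h₁.seven_le_gapLo neg_one_mem + 1) = b₂.parHi h₁.κ_pos h₂.seven_le_gapHi (v := 1) ⟨by norm_num, by norm_num⟩ := by
  have hκ := h₁.κ_pos
  constructor
  · refine junctionClock_eq_parLo b₁ b₂ hκ h₁.seven_le_gapLo h₁.seven_le_gapHi h₂.seven_le_gapLo h₂.seven_le_gapHi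
      ⟨b₁.parHi_le_parHi hκ h₁.seven_le_gapHi neg_one_mem neg_half_mem (by norm_num),
        b₁.parHi_le_parHi hκ h₁.seven_le_gapHi neg_five_mem neg_one_mem (by norm_num)⟩ _ ?_
    rw [b₁.alphaHi_parHi hκ h₁.seven_le_gapHi neg_one_mem]
  · refine junctionClock_eq_parHi b₁ b₂ hκ h₁.seven_le_gapLo h₁.seven_le_gapHi h₂.seven_le_gapLo h₂.seven_le_gapHi
      ⟨by linarith [b₁.parLo_le_parLo hκ h₁.seven_le_gapLo neg_five_mem neg_one_mem (by norm_num)],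
        by linarith [b₁.parLo_le_parLo hκ h₁.seven_le_gapLo neg_one_mem neg_half_mem (by norm_num)]⟩ _ ?_
    rw [add_sub_cancel_right, b₁.alphaLo_parLo hκ h₁.seven_le_gapLo neg_one_mem]

/-- The parameter map agrees with the junction clock on the closed middle piece. [folklore] -/
theorem northParam_eqOn_jc :
    EqOn (northParam h₁ h₂) (jc h₁ h₂) (Icc (b₁.parHi h₁.κ_pos h₁.seven_le_gapHi neg_one_mem) (b₁.parLo h₁.κ_pos h₁.seven_le_gapLo neg_one_mem + 1)) := by
  have hκ := h₁.κ_pos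
  obtain ⟨m1, -, -, m4⟩ := unroll_marks h₁
  obtain ⟨j1, j2⟩ := jc_junctions h₁ h₂
  intro τ hτ
  rcases hτ.1.eq_or_lt with h1 | h1
  · rw [← h1, j1, northParam_of_le h₁ h₂ ⟨m1, le_rfl⟩]
    exact b₂.parLo_congr' hκ h₂.seven_le_gapLo _ _ (by rw [b₁.alphaHi_parHi hκ h₁.seven_le_gapHi neg_one_mem]; norm_num)
  rcases hτ.2.lt_or_eq with h2 | h2
  · exact northParam_of_mem h₁ h₂ ⟨h1, h2⟩
  · rw [h2, j2, northParam_of_ge h₁ h₂ ⟨le_rfl, by linarith⟩]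
    exact b₂.parHi_congr' hκ h₂.seven_le_gapHi _ _ (by rw [add_sub_cancel_right, b₁.alphaLo_parLo hκ h₁.seven_le_gapLo neg_one_mem]; norm_num)

/-- **The parameter map is strictly increasing on `[tcHi₁, tcLo₁ + 1]`.** [folklore] -/
theorem strictMonoOn_northParam : StrictMonoOn (northParam h₁ h₂) (Icc b₁.tcHi (b₁.tcLo + 1)) := by
  have hκ := h₁.κ_pos
  obtain ⟨m1, m2, m3, m4⟩ := unroll_marks h₁
  have hε := b₁.epsLo_bounds.1
  have hε' := b₁.epsHi_bounds.1
  set c₁ := b₁.parHi hκ h₁.seven_le_gapHi neg_one_mem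
  set c₂ := b₁.parLo hκ h₁.seven_le_gapLo neg_one_mem + 1
  -- piece 1
  have p1 : StrictMonoOn (northParam h₁ h₂) (Icc b₁.tcHi c₁) := by
    intro τ hτ τ' hτ' hlt
    rw [northParam_of_le h₁ h₂ hτ, northParam_of_le h₁ h₂ hτ']
    refine b₂.parLo_lt_parLo hκ h₂.seven_le_gapLo _ _ ?_
    have hc : τ ∈ Icc (b₁.tcHi - b₁.epsHi / 8) (b₁.tcHi + b₁.epsHi / 8) :=
      ⟨by linarith [hτ.1], hτ.2.trans (b₁.parHi_mem_core hκ h₁.seven_le_gapHi neg_one_mem).2⟩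
    have hc' : τ' ∈ Icc (b₁.tcHi - b₁.epsHi / 8) (b₁.tcHi + b₁.epsHi / 8) :=
      ⟨by linarith [hτ'.1], hτ'.2.trans (b₁.parHi_mem_core hκ h₁.seven_le_gapHi neg_one_mem).2⟩
    linarith [b₁.strictAntiOn_alphaHi hκ hc hc' hlt]
  -- piece 2
  have p2 : StrictMonoOn (northParam h₁ h₂) (Icc c₁ c₂) := by
    refine StrictMonoOn.congr ?_ (northParam_eqOn_jc h₁ h₂).symm
    exact (strictMonoOn_junctionClock b₁ b₂ hκ h₁.seven_le_gapLo h₁.seven_le_gapHi h₂.seven_le_gapLo h₂.seven_le_gapHi).mono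
      (Icc_subset_Icc (b₁.parHi_le_parHi hκ h₁.seven_le_gapHi neg_one_mem neg_half_mem (by norm_num))
        (by linarith [b₁.parLo_le_parLo hκ h₁.seven_le_gapLo neg_one_mem neg_half_mem (by norm_num)]))
  -- piece 3
  have p3 : StrictMonoOn (northParam h₁ h₂) (Icc c₂ (b₁.tcLo + 1)) := by
    intro τ hτ τ' hτ' hlt
    rw [northParam_of_ge h₁ h₂ hτ, northParam_of_ge h₁ h₂ hτ']
    refine b₂.parHi_lt_parHi hκ h₂.seven_le_gapHi _ _ ?_
    have h0 := (b₁.parLo_mem_core hκ h₁.seven_le_gapLo neg_one_mem).1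
    have hc : τ - 1 ∈ Icc (b₁.tcLo - b₁.epsLo / 8) (b₁.tcLo + b₁.epsLo / 8) := ⟨by linarith [hτ.1], by linarith [hτ.2]⟩
    have hc' : τ' - 1 ∈ Icc (b₁.tcLo - b₁.epsLo / 8) (b₁.tcLo + b₁.epsLo / 8) := ⟨by linarith [hτ'.1], by linarith [hτ'.2]⟩
    linarith [b₁.strictMonoOn_alphaLo hκ hc hc' (by linarith)]
  have u12 : StrictMonoOn (northParam h₁ h₂) (Icc b₁.tcHi c₂) := by
    rw [← Icc_union_Icc_eq_Icc m1 (by linarith)]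
    exact p1.union p2 ⟨⟨m1, le_rfl⟩, fun x hx ↦ hx.2⟩ ⟨⟨le_rfl, by linarith⟩, fun x hx ↦ hx.1⟩
  rw [← Icc_union_Icc_eq_Icc (show b₁.tcHi ≤ c₂ by linarith) (by linarith)]
  exact u12.union p3 ⟨⟨by linarith, le_rfl⟩, fun x hx ↦ hx.2⟩ ⟨⟨le_rfl, by linarith⟩, fun x hx ↦ hx.1⟩

/-- The parameter map at the two ends of the unrolled interval: the core centres of `b₂`.
[folklore] -/
theorem northParam_ends : northParam h₁ h₂ b₁.tcHi = b₂.tcLo ∧ northParam h₁ h₂ (b₁.tcLo + 1) = b₂.tcHi := by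
  have hκ := h₁.κ_pos
  obtain ⟨m1, -, -, m4⟩ := unroll_marks h₁
  constructor
  · rw [northParam_of_le h₁ h₂ ⟨le_rfl, m1⟩, ← b₂.parLo_zero hκ h₂.seven_le_gapLo]
    exact b₂.parLo_congr' hκ h₂.seven_le_gapLo _ _ (by rw [b₁.alphaHi_tcHi]; norm_num)
  · rw [northParam_of_ge h₁ h₂ ⟨by linarith, le_rfl⟩, ← b₂.parHi_zero hκ h₂.seven_le_gapHi]
    exact b₂.parHi_congr' hκ h₂.seven_le_gapHi _ _ (by rw [add_sub_cancel_right, b₁.alphaLo_tcLo]; norm_num)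

/-- **The parameter map takes values in `[tcLo₂, tcHi₂]`.** [folklore] -/
theorem northParam_mem {τ : ℝ} (hτ : τ ∈ Icc b₁.tcHi (b₁.tcLo + 1)) : northParam h₁ h₂ τ ∈ Icc b₂.tcLo b₂.tcHi := by
  obtain ⟨e1, e2⟩ := northParam_ends h₁ h₂
  have hm := (strictMonoOn_northParam h₁ h₂).monotoneOn
  have hle : b₁.tcHi ≤ b₁.tcLo + 1 := hτ.1.trans hτ.2
  exact ⟨e1 ▸ hm ⟨le_rfl, hle⟩ hτ hτ.1, e2 ▸ hm hτ ⟨hle, le_rfl⟩ hτ.2⟩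

/-- `[tcLo₂, tcHi₂]` lies in the arc domain `[parLo₂ (-3), parHi₂ (-3)]`. [folklore] -/
theorem Icc_centres_subset :
    Icc b₂.tcLo b₂.tcHi ⊆ Icc (b₂.parLo h₁.κ_pos h₂.seven_le_gapLo neg_three_mem) (b₂.parHi h₁.κ_pos h₂.seven_le_gapHi neg_three_mem) := by
  have hκ := h₁.κ_pos
  refine Icc_subset_Icc ?_ ?_
  · rw [← b₂.parLo_zero hκ h₂.seven_le_gapLo]; exact b₂.parLo_le_parLo hκ h₂.seven_le_gapLo neg_three_mem _ (by norm_num)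
  · rw [← b₂.parHi_zero hκ h₂.seven_le_gapHi]; exact b₂.parHi_le_parHi hκ h₂.seven_le_gapHi neg_three_mem _ (by norm_num)

/-- **The northLift** of a northern parameter of the fundamental domain to the unrolled interval.
[folklore] -/
def northLift (s : ℝ) : ℝ := if s ≤ b₁.tcLo then s + 1 else s

/-- **The northern part of the flip frame through the parameter map**: for
`s ∈ [alo₁, alo₁ + 1) \ (tcLo₁, tcHi₁)`, `flipBase u s = foreignPt u (northParam (northLift s))` with
`northLift s ∈ [tcHi₁, tcLo₁ + 1]`. [folklore] -/
theorem flipBase_eq_foreignPt_northParam (hP : IsFlipPair b₁ b₂) (u : ℝ) {s : ℝ} (hs : s ∈ Ico b₁.alo (b₁.alo + 1))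
    (hs' : s ∉ Ioo b₁.tcLo b₁.tcHi) :
    flipBase h₁ h₂ u s = foreignPt h₁ h₂ u (northParam h₁ h₂ (northLift (b₁ := b₁) s)) ∧ northLift (b₁ := b₁) s ∈ Icc b₁.tcHi (b₁.tcLo + 1) := by
  have hκ := h₁.κ_pos
  obtain ⟨m1, m2, m3, m4⟩ := unroll_marks h₁
  have hcm := b₁.core_marks
  have hε := b₁.epsLo_bounds.1
  have hε' := b₁.epsHi_bounds.1
  have q1 : b₁.parHi hκ h₁.seven_le_gapHi neg_three_quarters_mem < b₁.parHi hκ h₁.seven_le_gapHi neg_one_mem :=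
    b₁.parHi_lt_parHi hκ h₁.seven_le_gapHi neg_one_mem neg_three_quarters_mem (by norm_num)
  have q2 : b₁.parLo hκ h₁.seven_le_gapLo neg_one_mem < b₁.parLo hκ h₁.seven_le_gapLo neg_three_quarters_mem :=
    b₁.parLo_lt_parLo hκ h₁.seven_le_gapLo neg_one_mem neg_three_quarters_mem (by norm_num)
  rcases le_or_gt s b₁.tcLo with h3 | h3
  · have hl : northLift (b₁ := b₁) s = s + 1 := if_pos h3
    rw [hl]
    refine ⟨?_, ⟨by linarith [hs.1], by linarith⟩⟩
    rcases lt_or_ge s (b₁.parLo hκ h₁.seven_le_gapLo neg_one_mem) with h1 | h1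
    · -- early foreign zone
      rw [flipBase_of_lt h₁ h₂ h1, theta_eq h₁ h₂ ⟨by linarith [hs.1], by linarith⟩,
        northParam_of_mem h₁ h₂ ⟨by linarith [hs.1], by linarith⟩]
    · -- lower core, level in `[-1, 0]`
      have hc : s ∈ Icc (b₁.tcLo - b₁.epsLo / 8) (b₁.tcLo + b₁.epsLo / 8) :=
        ⟨(b₁.parLo_mem_core hκ h₁.seven_le_gapLo neg_one_mem).1.trans h1, by linarith⟩
      have hv := neg_alphaLo_mem h₁ (τ := s + 1) ⟨by linarith, by linarith⟩
      have hv' := hv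
      rw [add_sub_cancel_right] at hv'
      rw [flipBase_of_mem h₁ h₂ ⟨h1, by linarith⟩, northParam_of_ge h₁ h₂ ⟨by linarith, by linarith⟩,
        foreignPt_eq_of_alphaHi_le h₁ h₂ (b₂.parHi_mem_core hκ h₂.seven_le_gapHi _) (by rw [b₂.alphaHi_parHi]; linarith [hv.2]),
        b₂.alphaHi_parHi, neckPiece_eq_reflect_railHiPsi h₁ h₂ hP hc (abs_lt.2 ⟨by linarith [hv'.2], by linarith [hv'.1]⟩)]
      simp only [add_sub_cancel_right]
  · have h4 : b₁.tcHi ≤ s := by by_contra h4; exact hs' ⟨h3, not_le.1 h4⟩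
    have hl : northLift (b₁ := b₁) s = s := if_neg (not_le.2 h3)
    rw [hl]
    refine ⟨?_, ⟨h4, by linarith [hs.2]⟩⟩
    rcases le_or_gt s (b₁.parHi hκ h₁.seven_le_gapHi neg_one_mem) with h2 | h2
    · -- upper core, level in `[-1, 0]`
      have hc : s ∈ Icc (b₁.tcHi - b₁.epsHi / 8) (b₁.tcHi + b₁.epsHi / 8) :=
        ⟨by linarith, h2.trans (b₁.parHi_mem_core hκ h₁.seven_le_gapHi neg_one_mem).2⟩
      have hv := neg_alphaHi_mem h₁ ⟨h4, h2⟩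
      rw [flipBase_of_mem h₁ h₂ ⟨by linarith, h2⟩, northParam_of_le h₁ h₂ ⟨h4, h2⟩,
        foreignPt_eq_of_alphaLo_le h₁ h₂ (b₂.parLo_mem_core hκ h₂.seven_le_gapLo _) (by rw [b₂.alphaLo_parLo]; linarith [hv.2]),
        b₂.alphaLo_parLo, neckPiece_eq_reflect_railLoPsi h₁ h₂ hP hc (abs_lt.2 ⟨by linarith [hv.2], by linarith [hv.1]⟩)]
    · -- late foreign zone
      rw [flipBase_of_gt h₁ h₂ h2, theta_eq h₁ h₂ ⟨by linarith, by linarith [hs.2]⟩, northParam_of_mem h₁ h₂ ⟨h2, by linarith [hs.2]⟩]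

/-- **THE FLIP FRAME IS INJECTIVE ON THE FUNDAMENTAL DOMAIN** (`A₁` north, `B₁` south, summands
of `b₁` disjoint, `B₂` south, `u ∈ [0, 1]`). [folklore] -/
theorem injOn_flipBase (hP : IsFlipPair b₁ b₂) (hA₁ : A₁.InNorth) (hB₁ : B₁.InSouth) (hAB₁ : Disjoint (range A₁) (range B₁))
    (hB₂ : B₂.InSouth) {u : ℝ} (hu : u ∈ Icc (0 : ℝ) 1) : InjOn (flipBase h₁ h₂ u) (Ico b₁.alo (b₁.alo + 1)) := by
  have hκ := h₁.κ_pos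
  obtain ⟨m1, m2, m3, m4⟩ := unroll_marks h₁
  have hcm := b₁.core_marks
  have hz : Ioo b₁.tcLo b₁.tcHi ⊆ Icc (b₁.parLo hκ h₁.seven_le_gapLo neg_seven_halves_mem) (b₁.parHi hκ h₁.seven_le_gapHi neg_five_quarters_mem) := by
    have h1 := b₁.parLo_le_parLo hκ h₁.seven_le_gapLo neg_seven_halves_mem neg_one_mem (by norm_num)
    have h2 := b₁.parHi_le_parHi hκ h₁.seven_le_gapHi neg_five_quarters_mem neg_one_mem (by norm_num)
    exact fun s hs ↦ ⟨by linarith [hs.1], by linarith [hs.2]⟩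
  intro s hs t ht hst
  by_cases hsS : s ∈ Ioo b₁.tcLo b₁.tcHi <;> by_cases htS : t ∈ Ioo b₁.tcLo b₁.tcHi
  · rw [flipBase_eq_neckPiece h₁ h₂ hP (hz hsS), flipBase_eq_neckPiece h₁ h₂ hP (hz htS)] at hst
    exact b₁.injOn_neckPiece_Ico hAB₁ h₁.κ_le_quarter hκ ⟨zero_le_one, le_rfl⟩ hs ht hst
  · have h1 := flipBase_last_neg h₁ h₂ hP hB₁ u hsS
    have h2 := flipBase_last_nonneg h₁ h₂ hA₁ hB₂ hu htS
    rw [hst] at h1; exact absurd h1 (not_lt.2 h2)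
  · have h1 := flipBase_last_neg h₁ h₂ hP hB₁ u htS
    have h2 := flipBase_last_nonneg h₁ h₂ hA₁ hB₂ hu hsS
    rw [← hst] at h1; exact absurd h1 (not_lt.2 h2)
  · obtain ⟨es, hls⟩ := flipBase_eq_foreignPt_northParam h₁ h₂ hP u hs hsS
    obtain ⟨et, hlt⟩ := flipBase_eq_foreignPt_northParam h₁ h₂ hP u ht htS
    rw [es, et] at hst
    have h1 : b₂.arcChart hκ h₂.seven_le_gapLo h₂.seven_le_gapHi u (northParam h₁ h₂ (northLift (b₁ := b₁) s)) =
        b₂.arcChart hκ h₂.seven_le_gapLo h₂.seven_le_gapHi u (northParam h₁ h₂ (northLift (b₁ := b₁) t)) :=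
      coe_reflectLast_psiN_symm_injective hst
    have h2 : northParam h₁ h₂ (northLift (b₁ := b₁) s) = northParam h₁ h₂ (northLift (b₁ := b₁) t) :=
      b₂.injOn_arcChart hκ h₂.seven_le_gapLo h₂.seven_le_gapHi h₂.flat h₂.nine_lt_r h₂.good h₂.eps_le_64 h₂.nine_lt_half hu
        (Icc_centres_subset h₁ h₂ (northParam_mem h₁ h₂ hls)) (Icc_centres_subset h₁ h₂ (northParam_mem h₁ h₂ hlt)) h1
    have h3 : northLift (b₁ := b₁) s = northLift (b₁ := b₁) t := (strictMonoOn_northParam h₁ h₂).injOn hls hlt h2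
    -- the northLift is injective on the northern part
    by_cases hs3 : s ≤ b₁.tcLo <;> by_cases ht3 : t ≤ b₁.tcLo
    · have e1 : northLift (b₁ := b₁) s = s + 1 := if_pos hs3
      have e2 : northLift (b₁ := b₁) t = t + 1 := if_pos ht3
      rw [e1, e2] at h3; linarith
    · have e1 : northLift (b₁ := b₁) s = s + 1 := if_pos hs3
      have e2 : northLift (b₁ := b₁) t = t := if_neg ht3
      rw [e1, e2] at h3; linarith [hs.1, ht.2]
    · have e1 : northLift (b₁ := b₁) s = s := if_neg hs3
      have e2 : northLift (b₁ := b₁) t = t + 1 := if_pos ht3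
      rw [e1, e2] at h3; linarith [ht.1, hs.2]
    · have e1 : northLift (b₁ := b₁) s = s := if_neg hs3
      have e2 : northLift (b₁ := b₁) t = t := if_neg ht3
      rw [e1, e2] at h3; exact h3

end Flip

end BandData

end Literature.Topology.FourManifolds
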